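import Summits.Ventures.Crystal3D.Theorems.StickyWulffConstantTextureLiminfBarlowSampleBonds
import Literature.MathematicalPhysics.StatisticalMechanics.BarlowCoordination
import HarnessLib

/-!
# Texture build, TB-A: greedy routing in a Barlow stacking, completeness and local agreement

The brick that replaces the «merge / transport» lemma of TB-0.md §9.1 (amendment §9.9 (S1)): grains are
the good grid cubes of the resolution, certified on ENLARGED cubes, and a face between two good cubes
inside perfect material is an agreement facet because of

* `exists_touching_form_lt` / `exists_touching_closer` — **greedy routing**: for two distinct sites
  `w ≠ p` of a (moved, ideal, Hägg) Barlow stacking there is a site `w'` touching `w` (`|w − w'| = 1`)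
  with `12|w' − p|² ≤ 12|w − p|² − 1` (the squared distances of sites are integers `/12`, Hales's form
  `3(2P+Q+Λ)² + (3Q+Λ)² + 8K²` of `BarlowCoordination`): in-layer one of the six neighbours decreases the
  hexagonal norm, across layers one of the three lower / upper neighbours does;
* `mem_of_perfect_near` — **perfect material is complete**: if every configuration ball within `R + 2`
  of an occupied site `p₀` lies on the stacking `S` and every ball within `R + 1` of `p₀` has `≥ 12`
  contacts, then EVERY site of `S` within `R` of `p₀` is occupied (strong induction on `12|w − p₀|²`
  along the routing: the closer neighbour is occupied, has twelve occupied stacking neighbours =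
  all of them, among which `w`);
* `mem_iff_mem_of_perfect_near` — **local agreement**: two stackings that both carry the balls near `p₀`
  coincide as site sets within `R` of `p₀` (each is complete there, so its sites are balls, which lie
  on the other).

Elementary; no packing hypothesis is needed (twelve contacts on a stacking are all its neighbours).
-/

noncomputable section

namespace Summit.Ventures.Crystal3D.Theorems

open Finset Summit.Ventures.Crystal3D
open Literature.MathematicalPhysics.StatisticalMechanics (barlowStacking barlowPos IsHaggSeq haggLabel
  sixOffsets threeOffsets twelve_mul_dist_barlowPos_sq dist_barlowPos_eq_iff
  haggLabel_sub_haggLabel_succ haggLabel_sub_haggLabel_pred)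
open Summit.Ventures.Crystal3D.Cruxes.TextureLiminf.TexShadow (E3 stacking)
open Summit.Ventures.Crystal3D.TentCertificate (hB hB_sq)

/-! ## Integer routing steps -/

/-- In-layer step: one of the six in-layer neighbour offsets strictly decreases the planar form
`3(2P+Q)² + (3Q)²` (`= 12 ×` the hexagonal norm) unless `(P, Q) = 0`. -/
theorem six_step (P Q : ℤ) (h : (P, Q) ≠ (0, 0)) :
    ∃ dP dQ : ℤ, (dP, dQ) ∈ sixOffsets ∧
      3 * (2 * (P - dP) + (Q - dQ)) ^ 2 + (3 * (Q - dQ)) ^ 2 < 3 * (2 * P + Q) ^ 2 + (3 * Q) ^ 2 := by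
  have mem : ∀ dP dQ : ℤ, (dP, dQ) = (1, 0) ∨ (dP, dQ) = (-1, 0) ∨ (dP, dQ) = (0, 1) ∨
      (dP, dQ) = (0, -1) ∨ (dP, dQ) = (1, -1) ∨ (dP, dQ) = (-1, 1) → (dP, dQ) ∈ sixOffsets := by
    intro dP dQ hd
    simp only [sixOffsets, Finset.mem_insert, Finset.mem_singleton]
    tauto
  by_cases h1 : 2 ≤ 2 * P + Q
  · exact ⟨1, 0, mem 1 0 (by simp), by nlinarith⟩
  by_cases h2 : 2 * P + Q ≤ -2
  · exact ⟨-1, 0, mem (-1) 0 (by simp), by nlinarith⟩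
  by_cases h3 : 2 ≤ P + 2 * Q
  · exact ⟨0, 1, mem 0 1 (by simp), by nlinarith⟩
  by_cases h4 : P + 2 * Q ≤ -2
  · exact ⟨0, -1, mem 0 (-1) (by simp), by nlinarith⟩
  by_cases h5 : 2 ≤ P - Q
  · exact ⟨1, -1, mem 1 (-1) (by simp), by nlinarith⟩
  by_cases h6 : P - Q ≤ -2
  · exact ⟨-1, 1, mem (-1) 1 (by simp), by nlinarith⟩
  exfalso
  apply h
  have hP : P = 0 := by omega
  have hQ : Q = 0 := by omega
  rw [hP, hQ]

/-- Layer step: one of the three adjacent-layer offsets for the letter shift `σ` strictly decreases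
`3X² + Y² + 8K²` when `K ≥ 1` (the new planar coordinates are `X − (2dP + dQ + σ)`, `Y − (3dQ + σ)`). -/
theorem three_step (σ : ℤ) (hσ : σ = 1 ∨ σ = -1) (X Y K : ℤ) (hK : 1 ≤ K) :
    ∃ dP dQ : ℤ, (dP, dQ) ∈ threeOffsets σ ∧
      3 * (X - (2 * dP + dQ + σ)) ^ 2 + (Y - (3 * dQ + σ)) ^ 2 + 8 * (K - 1) ^ 2 <
        3 * X ^ 2 + Y ^ 2 + 8 * K ^ 2 := by
  rcases hσ with rfl | rfl
  · have mem : ∀ dP dQ : ℤ, (dP, dQ) = (0, 0) ∨ (dP, dQ) = (-1, 0) ∨ (dP, dQ) = (0, -1) →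
        (dP, dQ) ∈ threeOffsets 1 := by
      intro dP dQ hd
      simp only [threeOffsets, if_true, Finset.mem_insert, Finset.mem_singleton]
      tauto
    by_cases hY : Y ≤ 0
    · exact ⟨0, -1, mem 0 (-1) (by simp), by nlinarith⟩
    by_cases hX : 0 ≤ X
    · exact ⟨0, 0, mem 0 0 (by simp), by nlinarith⟩
    · exact ⟨-1, 0, mem (-1) 0 (by simp), by nlinarith⟩
  · have mem : ∀ dP dQ : ℤ, (dP, dQ) = (0, 0) ∨ (dP, dQ) = (1, 0) ∨ (dP, dQ) = (0, 1) →
        (dP, dQ) ∈ threeOffsets (-1) := by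
      intro dP dQ hd
      simp only [threeOffsets, show (-1 : ℤ) ≠ 1 by decide, if_false, Finset.mem_insert,
        Finset.mem_singleton]
      tauto
    by_cases hY : 0 ≤ Y
    · exact ⟨0, 1, mem 0 1 (by simp), by nlinarith⟩
    by_cases hX : X ≤ 0
    · exact ⟨0, 0, mem 0 0 (by simp), by nlinarith⟩
    · exact ⟨1, 0, mem 1 0 (by simp), by nlinarith⟩

/-- Hales's integer form `3(2P+Q+Λ)² + (3Q+Λ)² + 8K²` of `12 ×` the squared distance of two sites. -/
def siteForm (s : ℤ → ℤ) (k i j k' i' j' : ℤ) : ℤ :=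
  3 * (2 * (i - i') + (j - j') + (haggLabel s k - haggLabel s k')) ^ 2 +
    (3 * (j - j') + (haggLabel s k - haggLabel s k')) ^ 2 + 8 * (k - k') ^ 2

/-- **Routing, index form**: from `(k,i,j) ≠ (k',i',j')` one of the twelve neighbours of `(k,i,j)`
has strictly smaller form towards `(k',i',j')`. -/
theorem exists_touching_form_lt {s : ℤ → ℤ} (hs : IsHaggSeq s) (k i j k' i' j' : ℤ)
    (hne : (k, i, j) ≠ (k', i', j')) :
    ∃ k₂ i₂ j₂ : ℤ,
      ((k₂ = k ∧ (i - i₂, j - j₂) ∈ sixOffsets) ∨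
        (k₂ = k + 1 ∧ (i - i₂, j - j₂) ∈ threeOffsets (-s k)) ∨
        (k₂ = k - 1 ∧ (i - i₂, j - j₂) ∈ threeOffsets (s (k - 1)))) ∧
      siteForm s k₂ i₂ j₂ k' i' j' < siteForm s k i j k' i' j' := by
  rcases lt_trichotomy k' k with hlt | heq | hgt
  · -- `K = k − k' ≥ 1`: step down to layer `k − 1`
    have hσ : s (k - 1) = 1 ∨ s (k - 1) = -1 := hs (k - 1)
    obtain ⟨dP, dQ, hmem, hlt'⟩ := three_step (s (k - 1)) hσ
      (2 * (i - i') + (j - j') + (haggLabel s k - haggLabel s k'))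
      (3 * (j - j') + (haggLabel s k - haggLabel s k')) (k - k') (by omega)
    refine ⟨k - 1, i - dP, j - dQ, Or.inr (Or.inr ⟨rfl, by simpa using hmem⟩), ?_⟩
    unfold siteForm
    have hL : haggLabel s (k - 1) = haggLabel s k - s (k - 1) := by
      have := haggLabel_sub_haggLabel_pred s k; linarith
    rw [hL]
    have e1 : 2 * (i - dP - i') + (j - dQ - j') + (haggLabel s k - s (k - 1) - haggLabel s k') =
        2 * (i - i') + (j - j') + (haggLabel s k - haggLabel s k') - (2 * dP + dQ + s (k - 1)) := by ring
    have e2 : 3 * (j - dQ - j') + (haggLabel s k - s (k - 1) - haggLabel s k') =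
        3 * (j - j') + (haggLabel s k - haggLabel s k') - (3 * dQ + s (k - 1)) := by ring
    have e3 : k - 1 - k' = k - k' - 1 := by ring
    rw [e1, e2, e3]
    exact hlt'
  · -- same layer
    subst heq
    have hPQ : (i - i', j - j') ≠ (0, 0) := by
      intro h0
      simp only [Prod.mk.injEq] at h0
      apply hne
      have hi : i = i' := by omega
      have hj : j = j' := by omega
      rw [hi, hj]
    obtain ⟨dP, dQ, hmem, hlt'⟩ := six_step (i - i') (j - j') hPQ
    refine ⟨k', i - dP, j - dQ, Or.inl ⟨rfl, by simpa using hmem⟩, ?_⟩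
    unfold siteForm
    rw [sub_self]
    have e1 : 2 * (i - dP - i') + (j - dQ - j') + 0 = 2 * (i - i' - dP) + (j - j' - dQ) := by ring
    have e2 : 3 * (j - dQ - j') + 0 = 3 * (j - j' - dQ) := by ring
    have e3 : 2 * (i - i') + (j - j') + 0 = 2 * (i - i') + (j - j') := by ring
    have e4 : 3 * (j - j') + 0 = 3 * (j - j') := by ring
    rw [e1, e2, e3, e4]
    nlinarith [hlt']
  · -- `K ≤ −1`: step up to layer `k + 1`
    have hτ : -s k = 1 ∨ -s k = -1 := by rcases hs k with h1 | h1 <;> omega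
    obtain ⟨dP, dQ, hmem, hlt'⟩ := three_step (-s k) hτ
      (2 * (i - i') + (j - j') + (haggLabel s k - haggLabel s k'))
      (3 * (j - j') + (haggLabel s k - haggLabel s k')) (k' - k) (by omega)
    refine ⟨k + 1, i - dP, j - dQ, Or.inr (Or.inl ⟨rfl, by simpa using hmem⟩), ?_⟩
    unfold siteForm
    have hL : haggLabel s (k + 1) = haggLabel s k + s k := by
      have := haggLabel_sub_haggLabel_succ s k; linarith
    rw [hL]
    have e1 : 2 * (i - dP - i') + (j - dQ - j') + (haggLabel s k + s k - haggLabel s k') =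
        2 * (i - i') + (j - j') + (haggLabel s k - haggLabel s k') - (2 * dP + dQ + -s k) := by ring
    have e2 : 3 * (j - dQ - j') + (haggLabel s k + s k - haggLabel s k') =
        3 * (j - j') + (haggLabel s k - haggLabel s k') - (3 * dQ + -s k) := by ring
    have e3 : (k + 1 - k') ^ 2 = (k' - k - 1) ^ 2 := by ring
    have e4 : (k - k') ^ 2 = (k' - k) ^ 2 := by ring
    rw [e1, e2, e3, e4]
    exact hlt'

/-! ## Geometric routing -/

/-- `12·|w − p|²` is the integer form, for sites of the ideal stacking (`a = 1`, `h = √(2/3)`). -/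
theorem twelve_mul_dist_sq_eq_siteForm (s : ℤ → ℤ) (k i j k' i' j' : ℤ) :
    12 * dist (barlowPos 1 hB s k i j) (barlowPos 1 hB s k' i' j') ^ 2 =
      (siteForm s k i j k' i' j' : ℝ) := by
  have h := twelve_mul_dist_barlowPos_sq (a := 1) (h := hB) (by rw [hB_sq]; norm_num) s k i j k' i' j'
  rw [h, one_pow, one_mul]
  unfold siteForm
  push_cast
  ring

/-- **Greedy routing in the ideal stacking**: a touching site strictly closer to the target, with the
integer gain `12|w' − p|² + 1 ≤ 12|w − p|²`. -/
theorem exists_touching_closer {s : ℤ → ℤ} (hs : IsHaggSeq s) {w p : E3}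
    (hw : w ∈ barlowStacking 1 hB s) (hp : p ∈ barlowStacking 1 hB s) (hne : w ≠ p) :
    ∃ w' ∈ barlowStacking 1 hB s, dist w w' = 1 ∧ 12 * dist w' p ^ 2 + 1 ≤ 12 * dist w p ^ 2 := by
  obtain ⟨k, i, j, rfl⟩ := hw
  obtain ⟨k', i', j', rfl⟩ := hp
  have hidx : (k, i, j) ≠ (k', i', j') := by
    intro h
    simp only [Prod.mk.injEq] at h
    obtain ⟨rfl, rfl, rfl⟩ := h
    exact hne rfl
  obtain ⟨k₂, i₂, j₂, hnb, hlt⟩ := exists_touching_form_lt hs k i j k' i' j' hidx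
  refine ⟨barlowPos 1 hB s k₂ i₂ j₂, ⟨k₂, i₂, j₂, rfl⟩, ?_, ?_⟩
  · exact (dist_barlowPos_eq_iff hs one_pos (by rw [hB_sq]; norm_num) k i j k₂ i₂ j₂).2 hnb
  · rw [twelve_mul_dist_sq_eq_siteForm, twelve_mul_dist_sq_eq_siteForm]
    exact_mod_cast Int.add_one_le_iff.2 hlt

/-- **Greedy routing in a moved stacking** `stacking L t σ`. -/
theorem exists_touching_closer_stacking {L : E3 ≃ₗᵢ[ℝ] E3} {t : E3} {σ : ℤ → ℤ} (hσ : IsHaggSeq σ)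
    {w p : E3} (hw : w ∈ stacking L t σ) (hp : p ∈ stacking L t σ) (hne : w ≠ p) :
    ∃ w' ∈ stacking L t σ, dist w w' = 1 ∧ 12 * dist w' p ^ 2 + 1 ≤ 12 * dist w p ^ 2 := by
  obtain ⟨r, hr, rfl⟩ := hw
  obtain ⟨r', hr', rfl⟩ := hp
  have hne' : r ≠ r' := fun h => hne (by rw [h])
  obtain ⟨w', hw', hd, hlt⟩ := exists_touching_closer hσ hr hr' hne'
  refine ⟨L w' + t, ⟨w', hw', rfl⟩, ?_, ?_⟩
  · rw [dist_add_right, LinearIsometryEquiv.dist_map]; exact hd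
  · rw [dist_add_right, LinearIsometryEquiv.dist_map, dist_add_right, LinearIsometryEquiv.dist_map]
    exact hlt

/-! ## Perfect material is complete; local agreement of two stackings -/

/-- **Perfect material is complete.**  `S = stacking L t σ`; `X` a finite configuration; `p₀ ∈ X ∩ S`;
every ball of `X` within `R + 2` of `p₀` lies on `S`; every ball within `R + 1` of `p₀` has at least
twelve contacts in `X`.  Then every site of `S` within `R` of `p₀` is a ball of `X`. -/
theorem mem_of_perfect_near {L : E3 ≃ₗᵢ[ℝ] E3} {t : E3} {σ : ℤ → ℤ} (hσ : IsHaggSeq σ)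
    (X : Finset E3) {p₀ : E3} (hp₀ : p₀ ∈ X) (hp₀S : p₀ ∈ stacking L t σ) (R : ℝ)
    (hS : ∀ x ∈ X, dist x p₀ ≤ R + 2 → x ∈ stacking L t σ)
    (h12 : ∀ x ∈ X, dist x p₀ ≤ R + 1 → 12 ≤ (X.filter fun y => dist x y = 1).card) :
    ∀ w ∈ stacking L t σ, dist w p₀ ≤ R → w ∈ X := by
  classical
  suffices H : ∀ n : ℕ, ∀ w ∈ stacking L t σ, 12 * dist w p₀ ^ 2 ≤ n → dist w p₀ ≤ R → w ∈ X by
    intro w hw hwR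
    exact H ⌈12 * dist w p₀ ^ 2⌉₊ w hw (Nat.le_ceil _) hwR
  intro n
  induction n with
  | zero =>
    intro w hw h0 _
    have hd : dist w p₀ = 0 := by
      have h1 : dist w p₀ ^ 2 ≤ 0 := by
        have := (Nat.cast_zero (R := ℝ)) ▸ h0
        linarith
      have h2 := sq_nonneg (dist w p₀)
      exact pow_eq_zero_iff (n := 2) (by norm_num) |>.1 (le_antisymm h1 h2)
    rw [dist_eq_zero.1 hd]; exact hp₀
  | succ n ih =>
    intro w hw hn hwR
    by_cases hwp : w = p₀
    · rw [hwp]; exact hp₀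
    obtain ⟨w', hw'S, hd1, hlt⟩ := exists_touching_closer_stacking hσ hw hp₀S hwp
    have hn' : 12 * dist w' p₀ ^ 2 ≤ n := by
      have : (12 * dist w' p₀ ^ 2 + 1 : ℝ) ≤ (n : ℝ) + 1 := by
        calc _ ≤ 12 * dist w p₀ ^ 2 := hlt
          _ ≤ _ := by exact_mod_cast hn
      linarith
    have hw'R : dist w' p₀ ≤ R := by
      have h1 : dist w' p₀ ^ 2 ≤ dist w p₀ ^ 2 := by linarith
      have h2 : dist w' p₀ ≤ dist w p₀ := (pow_le_pow_iff_left₀ dist_nonneg dist_nonneg (by norm_num)).1 h1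
      exact h2.trans hwR
    have hw'X : w' ∈ X := ih w' hw'S hn' hw'R
    -- the twelve contacts of `w'` are on `S`, hence they are ALL its stacking neighbours
    have hC := h12 w' hw'X (by linarith)
    set C := X.filter fun y => dist w' y = 1 with hCdef
    have hCsub : (↑C : Set E3) ⊆ {y | y ∈ stacking L t σ ∧ dist w' y = 1} := by
      intro y hy
      rw [Finset.mem_coe, hCdef, Finset.mem_filter] at hy
      refine ⟨hS y hy.1 ?_, hy.2⟩
      calc dist y p₀ ≤ dist y w' + dist w' p₀ := dist_triangle _ _ _
        _ ≤ 1 + R := by rw [dist_comm, hy.2]; linarith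
        _ ≤ R + 2 := by linarith
    have hT := ncard_touching_stacking_eq_twelve hσ hw'S
    have hTfin : {y | y ∈ stacking L t σ ∧ dist w' y = 1}.Finite := Set.finite_of_ncard_pos (by omega)
    have hEq : (↑C : Set E3) = {y | y ∈ stacking L t σ ∧ dist w' y = 1} :=
      Set.eq_of_subset_of_ncard_le hCsub (by rw [hT, Set.ncard_coe_finset]; exact hC) hTfin
    have hwT : w ∈ {y | y ∈ stacking L t σ ∧ dist w' y = 1} := ⟨hw, by rw [dist_comm]; exact hd1⟩
    rw [← hEq, Finset.mem_coe, hCdef, Finset.mem_filter] at hwT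
    exact hwT.1

/-- **Local agreement of two stackings.**  If two (moved, Hägg) stackings both carry the balls of `X`
within `R + 2` of a common occupied site `p₀`, and the balls within `R + 1` of `p₀` have twelve contacts,
then the two stackings have the same sites within `R` of `p₀`. -/
theorem mem_iff_mem_of_perfect_near {L₁ L₂ : E3 ≃ₗᵢ[ℝ] E3} {t₁ t₂ : E3} {σ₁ σ₂ : ℤ → ℤ}
    (hσ₁ : IsHaggSeq σ₁) (hσ₂ : IsHaggSeq σ₂) (X : Finset E3) {p₀ : E3} (hp₀ : p₀ ∈ X)
    (hp₀S₁ : p₀ ∈ stacking L₁ t₁ σ₁) (hp₀S₂ : p₀ ∈ stacking L₂ t₂ σ₂) (R : ℝ)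
    (hS₁ : ∀ x ∈ X, dist x p₀ ≤ R + 2 → x ∈ stacking L₁ t₁ σ₁)
    (hS₂ : ∀ x ∈ X, dist x p₀ ≤ R + 2 → x ∈ stacking L₂ t₂ σ₂)
    (h12 : ∀ x ∈ X, dist x p₀ ≤ R + 1 → 12 ≤ (X.filter fun y => dist x y = 1).card) :
    ∀ z : E3, dist z p₀ ≤ R → (z ∈ stacking L₁ t₁ σ₁ ↔ z ∈ stacking L₂ t₂ σ₂) := by
  intro z hz
  constructor
  · intro hz₁
    have hzX := mem_of_perfect_near hσ₁ X hp₀ hp₀S₁ R hS₁ h12 z hz₁ hz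
    exact hS₂ z hzX (by linarith)
  · intro hz₂
    have hzX := mem_of_perfect_near hσ₂ X hp₀ hp₀S₂ R hS₂ h12 z hz₂ hz
    exact hS₁ z hzX (by linarith)

/-- Set form of the local agreement, as consumed by `Mesh.hagree`: the two stackings coincide on every
ball contained in `closedBall p₀ R`. -/
theorem inter_ball_eq_of_perfect_near {L₁ L₂ : E3 ≃ₗᵢ[ℝ] E3} {t₁ t₂ : E3} {σ₁ σ₂ : ℤ → ℤ}
    (hσ₁ : IsHaggSeq σ₁) (hσ₂ : IsHaggSeq σ₂) (X : Finset E3) {p₀ : E3} (hp₀ : p₀ ∈ X)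
    (hp₀S₁ : p₀ ∈ stacking L₁ t₁ σ₁) (hp₀S₂ : p₀ ∈ stacking L₂ t₂ σ₂) (R : ℝ)
    (hS₁ : ∀ x ∈ X, dist x p₀ ≤ R + 2 → x ∈ stacking L₁ t₁ σ₁)
    (hS₂ : ∀ x ∈ X, dist x p₀ ≤ R + 2 → x ∈ stacking L₂ t₂ σ₂)
    (h12 : ∀ x ∈ X, dist x p₀ ≤ R + 1 → 12 ≤ (X.filter fun y => dist x y = 1).card)
    {y : E3} {r : ℝ} (hyr : Metric.ball y r ⊆ Metric.closedBall p₀ R) :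
    stacking L₁ t₁ σ₁ ∩ Metric.ball y r = stacking L₂ t₂ σ₂ ∩ Metric.ball y r := by
  ext z
  simp only [Set.mem_inter_iff]
  constructor
  · rintro ⟨hz, hzb⟩
    exact ⟨(mem_iff_mem_of_perfect_near hσ₁ hσ₂ X hp₀ hp₀S₁ hp₀S₂ R hS₁ hS₂ h12 z
      (Metric.mem_closedBall.1 (hyr hzb))).1 hz, hzb⟩
  · rintro ⟨hz, hzb⟩
    exact ⟨(mem_iff_mem_of_perfect_near hσ₁ hσ₂ X hp₀ hp₀S₁ hp₀S₂ R hS₁ hS₂ h12 z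
      (Metric.mem_closedBall.1 (hyr hzb))).2 hz, hzb⟩

end Summit.Ventures.Crystal3D.Theorems
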